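import Mathlib
import Summits.ResolutionOfSingularities.ResolutionOfSingularities.Theorems.WeightedInvariantContactFiltrationCanonical
import HarnessLib

/-!
# Terminal systems reach the maximal contact level (door `HypersurfaceCentreConstruction`, rung P2, (o24-C)/(o24-G) core)

Topic: `Summits/ResolutionOfSingularities/ResolutionOfSingularities/Theorems`. Helper for the door item
`HypersurfaceCentreConstruction` (statement `stmt-ResolutionOfSingularities-19897`, route `WeightedInvariant`),
line `local-engine` of `res-L1-w43-plan-1` (L W4.3), ORDER (o24) «rung P2 with the intrinsic pair (iotaOrd, jContact)»
(RULING gen 9 #4 (3)): def-free core C5 of piece (o24-C) (hand res-type-078), also consumed by (o24-G): **a TERMINAL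
prepared system of the dimension-two steepening process reaches the maximal contact level**, so the terminal system
`(x, y_T, b_T)` of the (o13) algorithm (K5 p509413/p511136, K6 p505670, K7) and ANY maximiser `g*` of (o24-D)'s `bMax`
define the SAME filtration (with C2 `ContactFiltration.contactFiltration_eq_of_mem`, p511384).

[OURS · L1 W4.3] Replaces the role of NO printed item; NOT a statement of the manuscript
[claim: Hironaka2017, status: under-review]. AI work, weaker than expert review.

## Statements (`S` regular local of dimension two, `(x, y) = 𝔪`, `J_b(n) = weightedMonomialIdeal ![x,y] ![1,b] n`,
contact filtration of `g` written out as `⨆ j, (g^j) 𝔪^{n - bj}`; `ν ≥ 1`, `b ≥ 1`, `f ∉ 𝔪^{ν+1}`)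

* `exists_face_of_mem_succ` (reduction): if `f ∈ J_b(bν)` and `g ∈ 𝔪 ∖ 𝔪²` carries `f` to level `b+1`, then EITHER
  the level-`b` face of `f` in `(x, y)` is a binomial row `r·C(ν,j)·μ^{ν-j}` (and `μ ∈ 𝔪` gives `f ∈ J_{b+1}((b+1)ν)`),
  OR `b = 1` and `f ≡ r μ^ν x^ν (mod 𝔪^{ν+1})` with `μ` a unit.
* **`not_mem_succ_of_caseC`** / **`not_mem_succ_of_caseD`**: a case-C resp. case-D TERMINAL system admits no
  `g ∈ 𝔪 ∖ 𝔪²` carrying `f` to level `b+1`; so `b = b_max` and, by C2, the terminal filtration is that of ANY maximiser.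
Proof: C2's key step gives `g ∈ (y) + 𝔪^b ⊆ (y) + (x^b)`, so `g = v y + μ x^b`; `v` a unit makes `g` a unit times the
steepening `y' = y + v⁻¹μ x^b`, and level `b+1` for `(x, y')` forces the level-`b` face of `f` to be the binomial row of
`r y'^ν` (K5 face calculus); `v ∈ 𝔪` forces `b = 1`, `μ` a unit, `f ≡ r μ^ν x^ν (mod 𝔪^{ν+1})`, against the unit
coefficient of `y^ν` (weighted quasi-regularity, K5 `face_coeff_mem_maximalIdeal`).

## References

* H. Hironaka, *Characteristic polyhedra of singularities*, J. Math. Kyoto Univ. 7 (1967) 251–293. [Hironaka1967]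
-/

noncomputable section

open IsLocalRing Literature.AlgebraicGeometry.Resolution

set_option linter.dupNamespace false -- mandated namespace of this single-conjunct summit

namespace Summit.ResolutionOfSingularities.ResolutionOfSingularities.Theorems

namespace ContactFiltration

universe u

variable {S : Type u} [CommRing S]

/-! ### Elementary inclusions -/

section Basic

variable [IsLocalRing S]

/-- Level monotonicity: level `(b+1)ν` of weight `b+1` lies in level `bν` of weight `b`. [folklore] -/
theorem contactFiltration_succ_level_le (g : S) (b ν : ℕ) :
    (⨆ j, Ideal.span {g ^ j} * maximalIdeal S ^ ((b + 1) * ν - (b + 1) * j)) ≤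
      ⨆ j, Ideal.span {g ^ j} * maximalIdeal S ^ (b * ν - b * j) := by
  refine iSup_le fun j => le_trans (Ideal.mul_mono_right (Ideal.pow_le_pow_right ?_)) (piece_le g b (b * ν) j)
  rw [← mul_tsub, ← mul_tsub]
  exact Nat.mul_le_mul_right _ (Nat.le_succ b)

omit [IsLocalRing S] in
/-- `(x, y)^b ⊆ (x^b) + (y)`. [folklore] -/
theorem span_pair_pow_le_span_pow_sup_span (x y : S) (b : ℕ) :
    Ideal.span {x, y} ^ b ≤ Ideal.span {x ^ b} ⊔ Ideal.span {y} := by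
  induction b with
  | zero =>
    rw [pow_zero, pow_zero, Ideal.span_singleton_one, Ideal.one_eq_top]
    exact le_sup_left
  | succ b ih =>
    rw [pow_succ]
    refine le_trans (Ideal.mul_mono_left ih) ?_
    rw [Ideal.sup_mul]
    refine sup_le ?_ (le_trans Ideal.mul_le_right le_sup_right)
    rw [Ideal.span_insert, Ideal.mul_sup]
    refine sup_le ?_ (le_trans Ideal.mul_le_left le_sup_right)
    rw [Ideal.span_singleton_mul_span_singleton, ← pow_succ]
    exact le_sup_left

omit [IsLocalRing S] in
/-- Level `(b+1)ν` of weight `b+1` of `(x, y)` lies in `(y^ν) + J_b(bν+1)`. [folklore] -/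
theorem weightedMonomialIdeal_succ_le (x y : S) (b ν : ℕ) :
    weightedMonomialIdeal ![x, y] ![1, b + 1] ((b + 1) * ν) ≤
      Ideal.span {y ^ ν} ⊔ weightedMonomialIdeal ![x, y] ![1, b] (b * ν + 1) := by
  rw [weightedMonomialIdeal, Ideal.span_le]
  rintro _ ⟨α, hα, rfl⟩
  simp only [Fin.sum_univ_two, Matrix.cons_val_zero, Matrix.cons_val_one, one_mul] at hα
  by_cases hj : ν ≤ α 1
  · refine Ideal.mem_sup_left ?_
    rw [Fin.prod_univ_two]
    simp only [Matrix.cons_val_zero, Matrix.cons_val_one]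
    obtain ⟨d, hd⟩ := Nat.exists_eq_add_of_le hj
    rw [hd, pow_add]
    exact Ideal.mul_mem_left _ _ (Ideal.mul_mem_right _ _ (Ideal.mem_span_singleton_self _))
  · refine Ideal.mem_sup_right (prod_pow_mem_weightedMonomialIdeal ![x, y] ![1, b] α ?_)
    simp only [Fin.sum_univ_two, Matrix.cons_val_zero, Matrix.cons_val_one, one_mul]
    push Not at hj
    have e1 : (b + 1) * ν - (b + 1) * α 1 = (b + 1) * (ν - α 1) := (mul_tsub _ _ _).symm
    have e2 : (b + 1) * (ν - α 1) = b * (ν - α 1) + (ν - α 1) := by ring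
    have e3 : b * (ν - α 1) = b * ν - b * α 1 := mul_tsub _ _ _
    have e4 : b * α 1 ≤ b * ν := Nat.mul_le_mul_left _ hj.le
    omega

/-- For `g ∈ 𝔪` and weight `b ≥ 2`, level `bν` lies in `(g^ν) + 𝔪^{ν+1}`. [folklore] -/
theorem contactFiltration_le_span_pow_sup_pow {g : S} (hg : g ∈ maximalIdeal S) {b : ℕ} (hb : 2 ≤ b) (ν : ℕ) :
    (⨆ j, Ideal.span {g ^ j} * maximalIdeal S ^ (b * ν - b * j)) ≤
      Ideal.span {g ^ ν} ⊔ maximalIdeal S ^ (ν + 1) := by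
  refine iSup_le fun j => ?_
  by_cases hj : ν ≤ j
  · refine le_trans Ideal.mul_le_right (le_trans ?_ le_sup_left)
    rw [Ideal.span_singleton_le_iff_mem, Ideal.mem_span_singleton]
    exact pow_dvd_pow g hj
  · push Not at hj
    have h1 : Ideal.span {g ^ j} ≤ maximalIdeal S ^ j := by
      rw [Ideal.span_singleton_le_iff_mem]; exact Ideal.pow_mem_pow hg j
    refine le_trans (Ideal.mul_mono_left h1) (le_trans ?_ le_sup_right)
    rw [← pow_add]
    refine Ideal.pow_le_pow_right ?_
    have e1 : b * ν - b * j = b * (ν - j) := (mul_tsub b ν j).symm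
    have e2 : 2 * (ν - j) ≤ b * (ν - j) := Nat.mul_le_mul_right _ hb
    omega

/-- `(v y + μ x)^ν ≡ (μ x)^ν (mod 𝔪^{ν+1})` when `x, y, v ∈ 𝔪` (the difference `v y` lies in `𝔪²`). [folklore] -/
theorem add_pow_sub_pow_mem {x y v : S} (hx : x ∈ maximalIdeal S) (hy : y ∈ maximalIdeal S)
    (hv : v ∈ maximalIdeal S) (μ : S) (ν : ℕ) :
    (v * y + μ * x) ^ ν - (μ * x) ^ ν ∈ maximalIdeal S ^ (ν + 1) := by
  induction ν with
  | zero => simp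
  | succ ν ih =>
    have hsplit : (v * y + μ * x) ^ (ν + 1) - (μ * x) ^ (ν + 1) =
        (v * y + μ * x) * ((v * y + μ * x) ^ ν - (μ * x) ^ ν) + (v * y) * (μ * x) ^ ν := by ring
    rw [hsplit, pow_succ']
    refine Ideal.add_mem _ (Ideal.mul_mem_mul ?_ ih) ?_
    · exact Ideal.add_mem _ (Ideal.mul_mem_left _ _ hy) (Ideal.mul_mem_left _ _ hx)
    · have h1 : v * y ∈ maximalIdeal S ^ 2 := by rw [pow_two]; exact Ideal.mul_mem_mul hv hy
      have h2 : (μ * x) ^ ν ∈ maximalIdeal S ^ ν := Ideal.pow_mem_pow (Ideal.mul_mem_left _ _ hx) ν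
      have := Ideal.mul_mem_mul h1 h2
      rw [← pow_add] at this
      rw [← pow_succ']
      exact Ideal.pow_le_pow_right (by omega) this

end Basic

/-! ### The reduction: a parameter reaching level `b + 1` -/

section Terminal

variable [IsRegularLocalRing S]

/-- **Reduction** (see the module docstring): a parameter `g ∈ 𝔪 ∖ 𝔪²` carrying `f ∈ J_b(bν)` to level `b+1` forces
either a binomial-row face at level `b` (and `f ∈ J_{b+1}((b+1)ν)` if `μ ∈ 𝔪`) or `b = 1` with
`f ≡ r μ^ν x^ν (mod 𝔪^{ν+1})`, `μ` a unit. [cite: Hironaka1967, Thm. (well-preparedness)] -/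
theorem exists_face_of_mem_succ (hdim : ringKrullDim S = (2 : ℕ)) {x y : S}
    (hxy : Ideal.span {x, y} = maximalIdeal S) {b ν : ℕ} (hb : 1 ≤ b) (hν : 1 ≤ ν) {f : S}
    (hford : f ∉ maximalIdeal S ^ (ν + 1)) (hfy : f ∈ weightedMonomialIdeal ![x, y] ![1, b] (b * ν))
    {g : S} (hg : g ∈ maximalIdeal S) (hg2 : g ∉ maximalIdeal S ^ 2)
    (hmem : f ∈ ⨆ j, Ideal.span {g ^ j} * maximalIdeal S ^ ((b + 1) * ν - (b + 1) * j)) :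
    (∃ r μ : S, f - ∑ j ∈ Finset.range (ν + 1), (r * (ν.choose j : S) * μ ^ (ν - j)) * (x ^ (b * (ν - j)) * y ^ j)
        ∈ weightedMonomialIdeal ![x, y] ![1, b] (b * ν + 1) ∧
      (μ ∈ maximalIdeal S → f ∈ weightedMonomialIdeal ![x, y] ![1, b + 1] ((b + 1) * ν))) ∨
    (b = 1 ∧ ∃ r μ : S, IsUnit μ ∧ f - r * μ ^ ν * x ^ ν ∈ maximalIdeal S ^ (ν + 1)) := by
  classical
  have hx : x ∈ maximalIdeal S := hxy ▸ Ideal.subset_span (by simp)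
  have hy : y ∈ maximalIdeal S := hxy ▸ Ideal.subset_span (by simp)
  have hy2 : y ∉ maximalIdeal S ^ 2 := (LocalGameEFTSteepening.not_mem_sq_of_span_pair_eq hdim hxy).2
  have hgy : g ∈ Ideal.span {y} ⊔ maximalIdeal S ^ b := by
    rcases Nat.lt_or_ge b 2 with hb1 | hb2
    · have hb1 : b = 1 := by omega
      subst hb1
      rw [pow_one]
      exact Ideal.mem_sup_right hg
    · have hfy' : f ∈ ⨆ j, Ideal.span {y ^ j} * maximalIdeal S ^ (b * ν - b * j) := by
        rw [← weightedMonomialIdeal_eq_contactFiltration hxy hb]; exact hfy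
      exact mem_span_sup_pow_of_mem_contactFiltration hg hy hy2 hb2 hν hford
        (contactFiltration_succ_level_le g b ν hmem) hfy'
  obtain ⟨ay, hay, m, hm, hgsum⟩ := Submodule.mem_sup.mp hgy
  obtain ⟨a, rfl⟩ := Ideal.mem_span_singleton'.mp hay
  have hm' : m ∈ Ideal.span {x ^ b} ⊔ Ideal.span {y} :=
    span_pair_pow_le_span_pow_sup_span x y b (by rw [hxy]; exact hm)
  obtain ⟨mx, hmx, my, hmy, hmsum⟩ := Submodule.mem_sup.mp hm'
  obtain ⟨μ, rfl⟩ := Ideal.mem_span_singleton'.mp hmx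
  obtain ⟨t, rfl⟩ := Ideal.mem_span_singleton'.mp hmy
  have hgeq : g = (a + t) * y + μ * x ^ b := by rw [← hgsum, ← hmsum]; ring
  by_cases hv : IsUnit (a + t)
  · -- (I) `g` is a unit times the steepening `y' = y + μ' x^b`
    left
    obtain ⟨v, hv'⟩ := hv
    set μ' : S := ↑v⁻¹ * μ with hμ'
    set y' : S := y - (-μ') * x ^ b with hy'def
    have hgy' : g = (v : S) * y' := by
      rw [hgeq, ← hv', hy'def, hμ']
      have : (v : S) * (↑v⁻¹ * μ) = μ := by rw [← mul_assoc, Units.mul_inv, one_mul]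
      rw [neg_mul, sub_neg_eq_add, mul_add, ← mul_assoc (v : S), this]
    have hxy' : Ideal.span {x, y'} = maximalIdeal S := by
      rw [hy'def, LocalGameEFTSteepening.span_pair_steepen_eq x y (-μ') hb, hxy]
    have hb1 : 1 ≤ b + 1 := by omega
    have hfy' : f ∈ weightedMonomialIdeal ![x, y'] ![1, b + 1] ((b + 1) * ν) := by
      rw [weightedMonomialIdeal_eq_contactFiltration hxy' hb1, ← contactFiltration_unit_mul v.isUnit y',
        ← hgy']
      exact hmem
    obtain ⟨ry, hry, j', hj', hsum⟩ := Submodule.mem_sup.mp (weightedMonomialIdeal_succ_le x y' b ν hfy')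
    obtain ⟨r, rfl⟩ := Ideal.mem_span_singleton'.mp hry
    refine ⟨r, μ', ?_, fun hμm => ?_⟩
    · -- the level-`b` face of `f` in `(x, y)` is the binomial row of `r y'^ν`
      have hface : f - r * y' ^ ν ∈ weightedMonomialIdeal ![x, y] ![1, b] (b * ν + 1) := by
        rw [← LocalGameEFTSteepening.weightedMonomialIdeal_steepen_eq x y (-μ') b, ← hy'def, ← hsum,
          add_sub_cancel_left]
        exact hj'
      rw [hy'def, LocalGameEFTSteepening.mul_steepen_pow_eq] at hface
      simpa only [neg_neg] using hface
    · -- `μ' ∈ 𝔪`: the two filtrations of weight `b+1` agree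
      have hμ'm : μ' ∈ maximalIdeal S := hμm
      have hsub : y' - y ∈ maximalIdeal S ^ (b + 1) := by
        rw [hy'def, show y - -μ' * x ^ b - y = μ' * x ^ b by ring, pow_succ']
        exact Ideal.mul_mem_mul hμ'm (Ideal.pow_mem_pow hx b)
      have e : weightedMonomialIdeal ![x, y'] ![1, b + 1] ((b + 1) * ν) =
          weightedMonomialIdeal ![x, y] ![1, b + 1] ((b + 1) * ν) := by
        refine weightedMonomialIdeal_eq_of_forall_sub_mem ![x, y] ![x, y'] ![1, b + 1]
          (Fin.forall_fin_two.2 ⟨by simp, ?_⟩) (Fin.forall_fin_two.2 ⟨by simp, ?_⟩) _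
        · simpa using LocalGameEFTSteepening.span_pair_pow_le x y hb1 (b + 1) (by rw [hxy]; exact hsub)
        · have hsub' : y - y' ∈ maximalIdeal S ^ (b + 1) := by
            rw [← neg_sub]; exact neg_mem hsub
          simpa using LocalGameEFTSteepening.span_pair_pow_le x y' hb1 (b + 1) (by rw [hxy']; exact hsub')
      rw [← e]
      exact hfy'
  · -- (II) `a + t ∈ 𝔪`: then `b = 1` and `μ` is a unit
    right
    have hvm : a + t ∈ maximalIdeal S := (IsLocalRing.mem_maximalIdeal _).mpr hv
    have hb1 : b = 1 := by
      by_contra hb1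
      apply hg2
      rw [hgeq, pow_two]
      refine Ideal.add_mem _ (Ideal.mul_mem_mul hvm hy) ?_
      rw [← pow_two]
      exact Ideal.mul_mem_left _ _ (Ideal.pow_le_pow_right (by omega) (Ideal.pow_mem_pow hx b))
    subst hb1
    have hμ : IsUnit μ := by
      by_contra hμ
      apply hg2
      rw [hgeq, pow_two, pow_one]
      exact Ideal.add_mem _ (Ideal.mul_mem_mul hvm hy) (Ideal.mul_mem_mul ((IsLocalRing.mem_maximalIdeal _).mpr hμ) hx)
    refine ⟨rfl, ?_⟩
    have h2 : f ∈ Ideal.span {g ^ ν} ⊔ maximalIdeal S ^ (ν + 1) :=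
      contactFiltration_le_span_pow_sup_pow hg (le_refl 2) ν (by simpa using hmem)
    obtain ⟨rg, hrg, m₂, hm₂, hsum₂⟩ := Submodule.mem_sup.mp h2
    obtain ⟨r, rfl⟩ := Ideal.mem_span_singleton'.mp hrg
    refine ⟨r, μ, hμ, ?_⟩
    have hgpow : g ^ ν - (μ * x) ^ ν ∈ maximalIdeal S ^ (ν + 1) := by
      rw [hgeq, pow_one]
      exact add_pow_sub_pow_mem hx hy hvm μ ν
    have : f - r * μ ^ ν * x ^ ν = m₂ + r * (g ^ ν - (μ * x) ^ ν) := by rw [← hsum₂, mul_pow]; ring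
    rw [this]
    exact Ideal.add_mem _ hm₂ (Ideal.mul_mem_left _ _ hgpow)

/-- **C5, case C — a terminal prepared system reaches the maximal contact level**: `(x, y) = 𝔪` in a two-dimensional
regular local ring, `f ≡ c y^ν (mod J_b(bν+1))` with `c` a unit, `f ∉ J_{b+1}((b+1)ν)`, `f ∉ 𝔪^{ν+1}`, `b, ν ≥ 1` ⇒ no
`g ∈ 𝔪 ∖ 𝔪²` carries `f` to level `b+1`. [cite: Hironaka1967, Thm. (well-preparedness)] -/
theorem not_mem_succ_of_caseC (hdim : ringKrullDim S = (2 : ℕ)) {x y : S}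
    (hxy : Ideal.span {x, y} = maximalIdeal S) {b ν : ℕ} (hb : 1 ≤ b) (hν : 1 ≤ ν) {f c : S} (hc : IsUnit c)
    (hford : f ∉ maximalIdeal S ^ (ν + 1))
    (hprep : f - c * y ^ ν ∈ weightedMonomialIdeal ![x, y] ![1, b] (b * ν + 1))
    (hnext : f ∉ weightedMonomialIdeal ![x, y] ![1, b + 1] ((b + 1) * ν))
    {g : S} (hg : g ∈ maximalIdeal S) (hg2 : g ∉ maximalIdeal S ^ 2) :
    f ∉ ⨆ j, Ideal.span {g ^ j} * maximalIdeal S ^ ((b + 1) * ν - (b + 1) * j) := by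
  classical
  intro hmem
  have hfy := LocalGameEFTSteepening.mem_of_sub_mul_pow_mem hprep
  rcases exists_face_of_mem_succ hdim hxy hb hν hford hfy hg hg2 hmem with
    ⟨r, μ, hface, hμ⟩ | ⟨hb1, r, μ, hμu, hfx⟩
  · -- two faces of `f` at level `b`: the binomial row and `(0, …, 0, c)`
    have hface0 := LocalGameEFTSteepening.face_of_sub_mul_pow_mem (x := x) hprep
    have hdiff : ∑ j ∈ Finset.range (ν + 1),
        (r * (ν.choose j : S) * μ ^ (ν - j) - (Pi.single ν c : ℕ → S) j) * (x ^ (b * (ν - j)) * y ^ j) ∈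
          weightedMonomialIdeal ![x, y] ![1, b] (b * ν + 1) := by
      have := Ideal.sub_mem _ hface0 hface
      simp only [sub_mul, Finset.sum_sub_distrib]
      convert this using 1
      ring
    have hν' : r * (ν.choose ν : S) * μ ^ (ν - ν) - (Pi.single ν c : ℕ → S) ν ∈ maximalIdeal S :=
      LocalGameEFTSteepening.face_coeff_mem_maximalIdeal hdim hxy hb _ hdiff le_rfl
    have h0' : r * (ν.choose 0 : S) * μ ^ (ν - 0) - (Pi.single ν c : ℕ → S) 0 ∈ maximalIdeal S :=
      LocalGameEFTSteepening.face_coeff_mem_maximalIdeal hdim hxy hb _ hdiff (Nat.zero_le _)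
    simp only [Nat.choose_self, Nat.cast_one, mul_one, Nat.sub_self, pow_zero, Pi.single_eq_same] at hν'
    rw [Pi.single_eq_of_ne (by omega : (0 : ℕ) ≠ ν), Nat.choose_zero_right, Nat.cast_one, mul_one, Nat.sub_zero,
      sub_zero] at h0'
    have hr : IsUnit r := by
      by_contra hr
      have : c ∈ maximalIdeal S := by
        have := Ideal.sub_mem _ ((IsLocalRing.mem_maximalIdeal _).mpr hr) hν'
        rwa [sub_sub_cancel] at this
      exact (IsLocalRing.mem_maximalIdeal _).mp this hc
    have hμν : μ ^ ν ∈ maximalIdeal S := (Ideal.unit_mul_mem_iff_mem _ hr).mp h0'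
    have hμ' : μ ∈ maximalIdeal S := (IsLocalRing.maximalIdeal.isMaximal S).isPrime.mem_of_pow_mem ν hμν
    exact hnext (hμ hμ')
  · -- `b = 1`: the tangent cone of `f` would be `r μ^ν X^ν`, against the unit coefficient of `y^ν`
    subst hb1
    have hprep1 : f - c * y ^ ν ∈ maximalIdeal S ^ (ν + 1) := by
      rw [← hxy, ← LocalGameEFTSteepening.weightedMonomialIdeal_one_eq_pow]; simpa using hprep
    have hdiff1 : c * y ^ ν - r * μ ^ ν * x ^ ν ∈ maximalIdeal S ^ (ν + 1) := by
      have := Ideal.sub_mem _ hfx hprep1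
      rwa [sub_sub_sub_cancel_left] at this
    -- read as a `(1,1)`-face with coefficients `single ν c - single 0 (r μ^ν)`
    have hsum : ∑ j ∈ Finset.range (ν + 1),
        ((Pi.single ν c : ℕ → S) j - (Pi.single 0 (r * μ ^ ν) : ℕ → S) j) * (x ^ (1 * (ν - j)) * y ^ j) =
          c * y ^ ν - r * μ ^ ν * x ^ ν := by
      have h1 : ∑ j ∈ Finset.range (ν + 1), (Pi.single ν c : ℕ → S) j * (x ^ (1 * (ν - j)) * y ^ j) =
          c * y ^ ν := by
        rw [Finset.sum_eq_single ν (fun j _ hj => by rw [Pi.single_eq_of_ne hj, zero_mul])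
          (fun h => absurd (Finset.self_mem_range_succ ν) h)]
        simp
      have h2 : ∑ j ∈ Finset.range (ν + 1),
          (Pi.single 0 (r * μ ^ ν) : ℕ → S) j * (x ^ (1 * (ν - j)) * y ^ j) = r * μ ^ ν * x ^ ν := by
        rw [Finset.sum_eq_single 0 (fun j _ hj => by rw [Pi.single_eq_of_ne hj, zero_mul])
          (fun h => absurd (Finset.mem_range.mpr (by omega)) h)]
        simp
      simp only [sub_mul, Finset.sum_sub_distrib, h1, h2]
    have hmemJ : ∑ j ∈ Finset.range (ν + 1),
        ((Pi.single ν c : ℕ → S) j - (Pi.single 0 (r * μ ^ ν) : ℕ → S) j) * (x ^ (1 * (ν - j)) * y ^ j) ∈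
          weightedMonomialIdeal ![x, y] ![1, 1] (1 * ν + 1) := by
      rw [hsum, one_mul, LocalGameEFTSteepening.weightedMonomialIdeal_one_eq_pow, hxy]
      exact hdiff1
    have hcν := LocalGameEFTSteepening.face_coeff_mem_maximalIdeal hdim hxy le_rfl _ hmemJ le_rfl
    rw [Pi.single_eq_same, Pi.single_eq_of_ne (by omega : ν ≠ 0), sub_zero] at hcν
    exact (IsLocalRing.mem_maximalIdeal _).mp hcν hc

/-- **C5, case D**: same conclusion when the level-`b` face `Σ_{j ≤ ν} a_j x^{b(ν-j)} y^j` of `f` has `a_ν` a unit and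
residues NOT a binomial row `c̄·C(ν,j)·(-λ̄)^{ν-j}` (face polynomial not `c̄ (s - λ̄)^ν`).
[cite: Hironaka1967, Thm. (well-preparedness)] -/
theorem not_mem_succ_of_caseD (hdim : ringKrullDim S = (2 : ℕ)) {x y : S}
    (hxy : Ideal.span {x, y} = maximalIdeal S) {b ν : ℕ} (hb : 1 ≤ b) (hν : 1 ≤ ν) {f : S}
    (hford : f ∉ maximalIdeal S ^ (ν + 1)) {a : ℕ → S} (haν : IsUnit (a ν))
    (hface : f - ∑ j ∈ Finset.range (ν + 1), a j * (x ^ (b * (ν - j)) * y ^ j) ∈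
      weightedMonomialIdeal ![x, y] ![1, b] (b * ν + 1))
    (hD : ∀ cbar lbar : ResidueField S, ∃ j ∈ Finset.range (ν + 1),
      residue S (a j) ≠ cbar * (ν.choose j : ResidueField S) * (-lbar) ^ (ν - j))
    {g : S} (hg : g ∈ maximalIdeal S) (hg2 : g ∉ maximalIdeal S ^ 2) :
    f ∉ ⨆ j, Ideal.span {g ^ j} * maximalIdeal S ^ ((b + 1) * ν - (b + 1) * j) := by
  classical
  intro hmem
  have hfy : f ∈ weightedMonomialIdeal ![x, y] ![1, b] (b * ν) := by
    have hs : ∑ j ∈ Finset.range (ν + 1), a j * (x ^ (b * (ν - j)) * y ^ j) ∈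
        weightedMonomialIdeal ![x, y] ![1, b] (b * ν) :=
      Ideal.sum_mem _ fun j hj => Ideal.mul_mem_left _ _
        (LocalGameEFTSteepening.faceMonomial_mem x y b ν (Nat.lt_succ_iff.mp (Finset.mem_range.mp hj)))
    have := Ideal.add_mem _ (weightedMonomialIdeal_antitone _ _ (Nat.le_succ _) hface) hs
    rwa [sub_add_cancel] at this
  rcases exists_face_of_mem_succ hdim hxy hb hν hford hfy hg hg2 hmem with
    ⟨r, μ, hface', -⟩ | ⟨hb1, r, μ, hμu, hfx⟩
  · have hdiff : ∑ j ∈ Finset.range (ν + 1),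
        (a j - r * (ν.choose j : S) * μ ^ (ν - j)) * (x ^ (b * (ν - j)) * y ^ j) ∈
          weightedMonomialIdeal ![x, y] ![1, b] (b * ν + 1) := by
      have := Ideal.sub_mem _ hface' hface
      simp only [sub_mul, Finset.sum_sub_distrib]
      convert this using 1
      ring
    obtain ⟨j, hj, hne⟩ := hD (residue S r) (-residue S μ)
    apply hne
    have hjν : j ≤ ν := Nat.lt_succ_iff.mp (Finset.mem_range.mp hj)
    have hmj := LocalGameEFTSteepening.face_coeff_mem_maximalIdeal hdim hxy hb _ hdiff hjν
    rw [← sub_eq_zero, ← map_natCast (residue S), neg_neg, ← map_pow, ← map_mul, ← map_mul, ← map_sub,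
      residue_eq_zero_iff]
    exact hmj
  · subst hb1
    have hface1 : f - ∑ j ∈ Finset.range (ν + 1), a j * (x ^ (1 * (ν - j)) * y ^ j) ∈
        maximalIdeal S ^ (ν + 1) := by
      rw [← hxy, ← LocalGameEFTSteepening.weightedMonomialIdeal_one_eq_pow]; simpa using hface
    have hdiff1 : ∑ j ∈ Finset.range (ν + 1), a j * (x ^ (1 * (ν - j)) * y ^ j) - r * μ ^ ν * x ^ ν ∈
        maximalIdeal S ^ (ν + 1) := by
      have := Ideal.sub_mem _ hfx hface1
      rwa [sub_sub_sub_cancel_left] at this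
    have hsingle : ∑ j ∈ Finset.range (ν + 1),
        (Pi.single 0 (r * μ ^ ν) : ℕ → S) j * (x ^ (1 * (ν - j)) * y ^ j) = r * μ ^ ν * x ^ ν := by
      rw [Finset.sum_eq_single 0 (fun j _ hj => by rw [Pi.single_eq_of_ne hj, zero_mul])
          (fun h => absurd (Finset.mem_range.mpr (by omega)) h)]
      simp
    have hsum : ∑ j ∈ Finset.range (ν + 1),
        (a j - (Pi.single 0 (r * μ ^ ν) : ℕ → S) j) * (x ^ (1 * (ν - j)) * y ^ j) =
          ∑ j ∈ Finset.range (ν + 1), a j * (x ^ (1 * (ν - j)) * y ^ j) - r * μ ^ ν * x ^ ν := by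
      simp only [sub_mul, Finset.sum_sub_distrib, hsingle]
    have hmemJ : ∑ j ∈ Finset.range (ν + 1),
        (a j - (Pi.single 0 (r * μ ^ ν) : ℕ → S) j) * (x ^ (1 * (ν - j)) * y ^ j) ∈
          weightedMonomialIdeal ![x, y] ![1, 1] (1 * ν + 1) := by
      rw [hsum, one_mul, LocalGameEFTSteepening.weightedMonomialIdeal_one_eq_pow, hxy]
      exact hdiff1
    have haν' := LocalGameEFTSteepening.face_coeff_mem_maximalIdeal hdim hxy le_rfl _ hmemJ le_rfl
    rw [Pi.single_eq_of_ne (by omega : ν ≠ 0), sub_zero] at haν'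
    exact (IsLocalRing.mem_maximalIdeal _).mp haν' haν

end Terminal

end ContactFiltration

end Summit.ResolutionOfSingularities.ResolutionOfSingularities.Theorems

end
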